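import Summits.QuantumFields.YangMills.Theorems.BalabanUVNodesN18PolLimitRateOfGeometricIncrements
import Summits.QuantumFields.YangMills.Theorems.BalabanUVNodesN18U3GuardsAtKernels

/-!
# BalabanUVNodes ∕ N18 — THE FADING-MEMORY ON-SITE MODEL: a non-zero, coupling-reading term family run through def-B's `polScalar ∘ expChart ∘ siteOfInt` whose
# windowed kernels are COMPUTED and meet W1-19b's four finite-volume kernel letters + the increments letter JOINTLY (A6 non-vacuity, MODEL LEVEL); N18 ∕ N22 + the guard
# (Track A, DAG node N18 = NE5; key K3⁷ `SpineGivenEndpointR13SepCoPH` = stmt-QuantumFields-20544, skeleton v5 941dddb108cbaacf; cell `pub-ymgap`, WIDTH SEAT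
# `pub-ymgap-dag-n18-w2` g6; `--supports stmt-QuantumFields-20544 --as helper`, COUNT-NEUTRAL; definition lane: four small `def`s, the rest theorems; 0 `sorry`)

WHY.  W1-19b `Node00/U3KernelLetters` (p595370) displays node U3's kernel inputs as finite-volume letters on def-B's windowed kernels `Node00.polWindow F K j ℰ ρ bV μ ν z`
(the (1.20) Hessian `polScalar` of the chart `B ↦ ℰ(exp ρB)` read at the torus window `siteOfInt F K j z`): `GeometricIncrements`, `WindowedDecay`, `WindowedNE9`,
`WindowedStepRate` (+ `PolLimitsExist`).  Their only inhabitant in the tree is the ZERO chart (`Record8Inhabited.polWindow_zeroChart`, dag-n22-w3 `polLimitExists_zeroChart`).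
Whether these SHAPES and their quantifier order (per-entry thresholds EVENTUALLY in `K` over PERIODIC torus windows; `Box ∕ Window`; the `(K+s, k+2) ∕ (K, k+1)`
two-run indexing with `Fin.tail`; `C'·θ₅^k` against moduli `Λ (k+1) i`) are jointly satisfiable by a family that READS the couplings was not checked.  THIS FILE checks it
on a scalar model (`𝔄 = V = ℝ`, `ρ = id`, basis `Module.Basis.singleton Unit ℝ`):
* §1 for `ℰ W = c · W μ₀ x₀` the (1.20) Hessian of the chart is ON-SITE — ★ `polTensor_expChart_evalMul` (`Real.hasDerivAt_exp`, `comp_hasFDerivAt`, `smul_const`).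
* §2 the FADING AMPLITUDE `fadingAmp ω k v = Σ_{i ≤ k} ω^{k+1−i} v_i` (`fadingAmp_succ`: `fadingAmp ω (k+1) w = ω^{k+2} w_0 + fadingAmp ω k (tail w)` — the two-run
  discrepancy IS the oldest coupling's weight), the term family `fadingTermFamily F ω`, its windowed kernel IN CLOSED FORM ★ `polWindow_fadingTermFamily`, the torus-window
  fact `siteOfInt_eventually_ne`, ★ `polWindow_fadingTermFamily_eventually` (eventually the on-site kernel `fadingAmp ω k v · [μ = ν = 0] · [z = 0]`), the (1.21) limit in
  closed form (`polLimit_∕kernelA_fadingTermFamily`) — and `betaMerged_fadingTermFamily`: the model's β ((1.22) at the pair `(0,1)`) is IDENTICALLY ZERO.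
* §3 the letters at the model (`0 ≤ ω < 1`, every window `Window γ`): `geometricIncrements_fading` (every `r`), `polLimitsExist_fading`, `windowedDecay_fading` (every `κ`),
  `windowedNE9_fading` (moduli `ω^{n−i}`), `windowedStepRate_fading` (every run offset `s`; `θ₅ = ω`, constant `(|γ|ω)·ω` = the `C₅·θ₅` shape), and through p606911 ∕
  dag-n22-w3: `kernelStepRate_fading` (node N18's LETTER), `ne9_EA_fading`, `kernelDecay_fading`.
* §4 at node U3's kernel objects with the letter block `fadingLetters γ ω = ⟨1, ω, |γ|ω, 1, ω, 0, ω⟩` (`Signs` for `0 < ω < 1`): `n18At_fading` ∕ `n22At_fading` at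
  `u3OfRecord₁₃ θ … k` for EVERY `θ : Stage13Params F N`, and ★ `sensitiveOnBoxes_fading`: the kernels are NON-ZERO and COUPLING-SENSITIVE over the boxes (n18-w2 g0's guard).

HONEST FRAMING.  A MODEL-LEVEL A6 witness: the finite-volume letter shapes of W1-19b are jointly satisfiable, through def-B's ACTUAL Hessian-and-window machinery, by a
non-zero family that reads the couplings.  NOT Bałaban's merged term (1.6); it inhabits NO letter OF RECORD (`…OfRecord₁₃` read `θ`'s own term data), NOT `Provisos₁₃CoPH`
(K0⁷ OPEN); nothing of Bałaban's asserted; NE5 NOT PRINTED for d = 4; N18 ∕ N22 ∕ (D4) NOT discharged; K3⁷ OPEN, not claimed; counts UNMOVED (typed 28∕28 · discharged 5∕27,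
A 5∕28); one finite 𝕋⁴ programme at fixed ε — R4 closes the conditional rung `BalabanLadder.UV` only: NOT ℝ⁴ ∕ infinite volume ∕ OS ∕ mass gap ∕ Clay.  Nothing landed edited.

Sources (types only): [Balaban1987RG1] CMP **109** (1987) (1.20)–(1.21) p. 264, Thm 1 p. 259, (1.18) p. 263, (5.10) p. 293; [Balaban1988RG2Cluster] CMP **116** (2.13)–(2.14).
-/

noncomputable section

open Filter Topology
open scoped BigOperators

namespace YMDAG.N18.FiniteVolumeLettersModel

open Literature.MathematicalPhysics.QuantumFieldTheory.Balaban1983to89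
open Literature.MathematicalPhysics.QuantumFieldTheory.Balaban1983to89.T4Continuum (T4Family)
open Literature.MathematicalPhysics.QuantumFieldTheory.Balaban1983to89.T4OutputRate (Window NE9)
open Literature.MathematicalPhysics.QuantumFieldTheory.Balaban1983to89.FlowStep (Box)
open Literature.MathematicalPhysics.QuantumFieldTheory.Balaban1983to89.T4FlagMemory (extd)
open Literature.MathematicalPhysics.QuantumFieldTheory.Balaban1983to89.B12PolarizationTensor120 (polTensor polComp expChart)
open Literature.MathematicalPhysics.QuantumFieldTheory.Balaban1983to89.Node00 (TermFamily1 siteOfInt polScalar polWindow polLimit PolLimitExists Stage13Params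
  U3Letters₁₁)
open Literature.MathematicalPhysics.QuantumFieldTheory.Balaban1983to89.Node00.U3OfKernels (histPrefix kernelA EA objects KernelDecay)
open Literature.MathematicalPhysics.QuantumFieldTheory.Balaban1983to89.Node00.U3KernelLetters (PolLimitsExist GeometricIncrements WindowedDecay WindowedNE9
  WindowedStepRate KernelStepRate)
open Literature.MathematicalPhysics.QuantumFieldTheory.Balaban1983to89.B12Sec2to5 (l1)
open YMDAG.UVSplit (N18At N22At u3OfRecord₁₃)
open YMDAG.N18.U3Guards (SensitiveOnBoxes)

/-! ## §1 The calculus fact: the (1.20) Hessian of the chart of an evaluation functional is on-site -/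

section Calculus

variable {Λ T : Type*} [Fintype Λ] [Fintype T]

/-- Evaluation of a bond field at one bond `(μ₀, x₀)`, as a continuous linear map. [folklore] -/
def bondEval (μ₀ : Λ) (x₀ : T) : (Λ → T → ℝ) →L[ℝ] ℝ :=
  (ContinuousLinearMap.proj x₀).comp (ContinuousLinearMap.proj (R := ℝ) (φ := fun _ : Λ => T → ℝ) μ₀)

omit [Fintype Λ] [Fintype T] in
/-- `bondEval μ₀ x₀ B = B μ₀ x₀`. [folklore] -/
@[simp] theorem bondEval_apply (μ₀ : Λ) (x₀ : T) (B : Λ → T → ℝ) : bondEval μ₀ x₀ B = B μ₀ x₀ := rfl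

omit [Fintype Λ] [Fintype T] in
/-- The chart `B ↦ ℰ(exp B)` of the evaluation functional `ℰ W = c · W μ₀ x₀` (scalar algebra, `ρ = id`) is `B ↦ c · e^{B μ₀ x₀}`.
[cite: Balaban1987RG1, p.264 (before (1.20)); model] -/
theorem expChart_evalMul (c : ℝ) (μ₀ : Λ) (x₀ : T) :
    expChart (F := ℝ) (fun W : Λ → T → ℝ => c * W μ₀ x₀) (ContinuousLinearMap.id ℝ ℝ) = fun B => c * Real.exp (bondEval μ₀ x₀ B) := by
  funext B
  simp [expChart, Real.exp_eq_exp_ℝ]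

/-- First derivative of the chart: `D(c·e^{B μ₀ x₀})(B) = (c·e^{B μ₀ x₀}) • ev_{μ₀,x₀}`. [folklore] -/
theorem hasFDerivAt_expChart_evalMul (c : ℝ) (μ₀ : Λ) (x₀ : T) (B : Λ → T → ℝ) :
    HasFDerivAt (fun B : Λ → T → ℝ => c * Real.exp (bondEval μ₀ x₀ B)) ((c * Real.exp (bondEval μ₀ x₀ B)) • bondEval μ₀ x₀) B :=
  ((Real.hasDerivAt_exp (bondEval μ₀ x₀ B)).const_mul c).comp_hasFDerivAt B (bondEval μ₀ x₀).hasFDerivAt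

/-- The derivative as a function. [folklore] -/
theorem fderiv_expChart_evalMul (c : ℝ) (μ₀ : Λ) (x₀ : T) :
    fderiv ℝ (fun B : Λ → T → ℝ => c * Real.exp (bondEval μ₀ x₀ B)) = fun B => (c * Real.exp (bondEval μ₀ x₀ B)) • bondEval μ₀ x₀ :=
  funext fun B => (hasFDerivAt_expChart_evalMul c μ₀ x₀ B).fderiv

/-- Second derivative of the chart at `B = 0`: `D²(c·e^{B μ₀ x₀})(0) = (c • ev) ⊗ ev` (as `smulRight`). [folklore] -/
theorem hasFDerivAt_fderiv_expChart_evalMul (c : ℝ) (μ₀ : Λ) (x₀ : T) :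
    HasFDerivAt (fderiv ℝ (fun B : Λ → T → ℝ => c * Real.exp (bondEval μ₀ x₀ B)))
      (((c * Real.exp (bondEval μ₀ x₀ 0)) • bondEval μ₀ x₀).smulRight (bondEval μ₀ x₀)) 0 := by
  rw [fderiv_expChart_evalMul]
  exact (hasFDerivAt_expChart_evalMul c μ₀ x₀ 0).smul_const (bondEval μ₀ x₀)

/-- ★ **THE (1.20) HESSIAN OF THE CHART OF AN EVALUATION FUNCTIONAL IS ON-SITE**: for `ℰ W = c · W μ₀ x₀` (scalar configurations),
`Π_{μν}(x, y)(v ⊗ w) = c · (δ_{μ,x}v)(μ₀, x₀) · (δ_{ν,y}w)(μ₀, x₀)`. [cite: Balaban1987RG1, (1.20) p.264; model] -/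
theorem polTensor_expChart_evalMul [DecidableEq Λ] [DecidableEq T] (c : ℝ) (μ₀ : Λ) (x₀ : T) (μ : Λ) (x : T) (v : ℝ) (ν : Λ) (y : T) (w : ℝ) :
    polTensor ℝ (expChart (F := ℝ) (fun W : Λ → T → ℝ => c * W μ₀ x₀) (ContinuousLinearMap.id ℝ ℝ)) μ x v ν y w =
      c * (Pi.single μ (Pi.single x v) : Λ → T → ℝ) μ₀ x₀ * (Pi.single ν (Pi.single y w) : Λ → T → ℝ) μ₀ x₀ := by
  rw [B12PolarizationTensor120.polTensor_def, expChart_evalMul, (hasFDerivAt_fderiv_expChart_evalMul c μ₀ x₀).fderiv]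
  simp [mul_assoc]

end Calculus

/-! ## §2 The fading-memory on-site model and its windowed kernels in closed form -/

section Model

/-- **THE FADING AMPLITUDE** `fadingAmp ω k v = Σ_{i ≤ k} ω^{k+1−i} · v_i` (the OLDEST coupling `v_0` weighs least, `ω^{k+1}`; the newest weighs `ω`). [folklore] -/
def fadingAmp (ω : ℝ) (k : ℕ) (v : Fin (k + 1) → ℝ) : ℝ :=
  ∑ i : Fin (k + 1), ω ^ (k + 1 - (i : ℕ)) * v i

/-- **THE TWO-RUN RECURSION** `fadingAmp ω (k+1) w = ω^{k+2} · w 0 + fadingAmp ω k (tail w)` — the model's N18 mechanism. [folklore] -/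
theorem fadingAmp_succ (ω : ℝ) (k : ℕ) (w : Fin (k + 2) → ℝ) :
    fadingAmp ω (k + 1) w = ω ^ (k + 2) * w 0 + fadingAmp ω k (Fin.tail w) := by
  unfold fadingAmp
  rw [Fin.sum_univ_succ]
  congr 1
  refine Finset.sum_congr rfl fun i _ => ?_
  simp only [Fin.val_succ, Fin.tail]
  congr 2
  omega

/-- At a single coupling the amplitude is `ω · v 0`. [folklore] -/
theorem fadingAmp_zero (ω : ℝ) (v : Fin 1 → ℝ) : fadingAmp ω 0 v = ω * v 0 := by
  simp [fadingAmp]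

/-- The amplitude difference at two histories. [folklore] -/
theorem fadingAmp_sub (ω : ℝ) (k : ℕ) (v v' : Fin (k + 1) → ℝ) :
    fadingAmp ω k v - fadingAmp ω k v' = ∑ i : Fin (k + 1), ω ^ (k + 1 - (i : ℕ)) * (v i - v' i) := by
  unfold fadingAmp
  rw [← Finset.sum_sub_distrib]
  exact Finset.sum_congr rfl fun i _ => by ring

/-- **HISTORY-LIPSCHITZ WITH FADING MODULI**: `|fadingAmp ω k v − fadingAmp ω k v'| ≤ Σ_i ω^{k+1−i} |v_i − v'_i|` (`0 ≤ ω`). [folklore] -/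
theorem abs_fadingAmp_sub_le {ω : ℝ} (hω : 0 ≤ ω) (k : ℕ) (v v' : Fin (k + 1) → ℝ) :
    |fadingAmp ω k v - fadingAmp ω k v'| ≤ ∑ i : Fin (k + 1), ω ^ (k + 1 - (i : ℕ)) * |v i - v' i| := by
  rw [fadingAmp_sub]
  refine (Finset.abs_sum_le_sum_abs _ _).trans (le_of_eq ?_)
  exact Finset.sum_congr rfl fun i _ => by rw [abs_mul, abs_of_nonneg (pow_nonneg hω _)]

/-- The total weight is at most `ω ∕ (1 − ω)`, uniformly in the level (`0 ≤ ω < 1`). [folklore] -/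
theorem sum_weights_le {ω : ℝ} (hω : 0 ≤ ω) (hω1 : ω < 1) (k : ℕ) :
    ∑ i : Fin (k + 1), ω ^ (k + 1 - (i : ℕ)) ≤ ω / (1 - ω) := by
  have h1 : ∑ i : Fin (k + 1), ω ^ (k + 1 - (i : ℕ)) = ∑ j ∈ Finset.range (k + 1), ω ^ (j + 1) := by
    rw [Fin.sum_univ_eq_sum_range (fun i => ω ^ (k + 1 - i)) (k + 1), ← Finset.sum_range_reflect (fun j => ω ^ (j + 1)) (k + 1)]
    refine Finset.sum_congr rfl fun j hj => ?_
    rw [Finset.mem_range] at hj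
    show ω ^ (k + 1 - j) = ω ^ (k + 1 - 1 - j + 1)
    congr 1
    omega
  have h2 : ∑ j ∈ Finset.range (k + 1), ω ^ (j + 1) = ω * ∑ j ∈ Finset.range (k + 1), ω ^ j := by
    rw [Finset.mul_sum]
    exact Finset.sum_congr rfl fun j _ => by ring
  rw [h1, h2, div_eq_mul_inv]
  exact mul_le_mul_of_nonneg_left (sum_le_hasSum _ (fun j _ => pow_nonneg hω j) (hasSum_geometric_of_lt_one hω hω1)) hω

/-- **UNIFORM BOUND ON THE BOXES**: for `v ∈ ]0, γ]^{k+1}`, `|fadingAmp ω k v| ≤ |γ| · (ω ∕ (1 − ω))`, uniformly in `k` (`0 ≤ ω < 1`). [folklore] -/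
theorem abs_fadingAmp_le {ω : ℝ} (hω : 0 ≤ ω) (hω1 : ω < 1) {γ : ℝ} {k : ℕ} {v : Fin (k + 1) → ℝ} (hv : v ∈ Box γ k) :
    |fadingAmp ω k v| ≤ |γ| * (ω / (1 - ω)) := by
  have hvi : ∀ i : Fin (k + 1), |v i| ≤ |γ| := fun i => by
    have h := hv i (Set.mem_univ i)
    rw [abs_of_pos h.1]
    exact h.2.trans (le_abs_self γ)
  calc |fadingAmp ω k v| ≤ ∑ i : Fin (k + 1), |ω ^ (k + 1 - (i : ℕ)) * v i| := Finset.abs_sum_le_sum_abs _ _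
    _ ≤ ∑ i : Fin (k + 1), ω ^ (k + 1 - (i : ℕ)) * |γ| := Finset.sum_le_sum fun i _ => by
        rw [abs_mul, abs_of_nonneg (pow_nonneg hω _)]
        exact mul_le_mul_of_nonneg_left (hvi i) (pow_nonneg hω _)
    _ = |γ| * ∑ i : Fin (k + 1), ω ^ (k + 1 - (i : ℕ)) := by rw [← Finset.sum_mul, mul_comm]
    _ ≤ |γ| * (ω / (1 - ω)) := mul_le_mul_of_nonneg_left (sum_weights_le hω hω1 k) (abs_nonneg γ)

/-- The amplitude is POSITIVE on the boxes for `ω > 0` (the model reads the couplings). [folklore] -/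
theorem fadingAmp_pos {ω : ℝ} (hω : 0 < ω) {γ : ℝ} {k : ℕ} {v : Fin (k + 1) → ℝ} (hv : v ∈ Box γ k) : 0 < fadingAmp ω k v :=
  Finset.sum_pos (fun i _ => mul_pos (pow_pos hω _) (hv i (Set.mem_univ i)).1) Finset.univ_nonempty

variable (F : T4Family)

/-- **THE FADING-MEMORY ON-SITE TERM FAMILY** (scalar model, `𝔄 = ℝ`): at level `k`, history `v`, volume `K`, the functional `W ↦ fadingAmp ω k v · W 0 (siteOfInt F K (k+1) 0)`
of scalar bond configurations of `T^{(k+1)}_K` (evaluation at the direction-`0` bond at the window's origin). [cite: Balaban1988RG2Cluster, (2.13) p.14; model] -/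
def fadingTermFamily (ω : ℝ) : TermFamily1 F ℝ :=
  fun k v K W => fadingAmp ω k v * W (Fin.cast (F.P_d K).symm 0) (siteOfInt F K (k + 1) 0)

/-- ★ **THE WINDOWED KERNEL IN CLOSED FORM** (chart `ρ = id`, basis `Module.Basis.singleton Unit ℝ`): `fadingAmp ω k v` when both directions are `0` and the window sends `z` to
the torus origin, else `0`. [cite: Balaban1987RG1, (1.20)–(1.21) p.264; model] -/
theorem polWindow_fadingTermFamily (ω : ℝ) (k : ℕ) (v : Fin (k + 1) → ℝ) (K : ℕ) (μ ν : Fin 4) (z : Fin 4 → ℤ) :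
    polWindow F K (k + 1) (fadingTermFamily F ω k v K) (ContinuousLinearMap.id ℝ ℝ) (Module.Basis.singleton Unit ℝ) μ ν z =
      if μ = 0 ∧ ν = 0 ∧ siteOfInt F K (k + 1) z = siteOfInt F K (k + 1) 0 then fadingAmp ω k v else 0 := by
  unfold polWindow polScalar fadingTermFamily
  simp only [polComp, Module.Basis.singleton_apply, Fintype.card_unique, Nat.cast_one, inv_one, one_mul, Finset.univ_unique,
    Finset.sum_singleton, polTensor_expChart_evalMul]
  have hμ : ∀ μ' : Fin 4, (Fin.cast (F.P_d K).symm 0 = Fin.cast (F.P_d K).symm μ') ↔ μ' = 0 := fun μ' =>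
    ⟨fun h => (Fin.cast_injective _ h).symm, fun h => by rw [h]⟩
  simp only [Pi.single_apply, hμ]
  by_cases h0 : μ = 0 <;> by_cases h1 : ν = 0 <;> by_cases h2 : siteOfInt F K (k + 1) z = siteOfInt F K (k + 1) 0 <;>
    simp [h0, h1, h2, eq_comm]

/-- **THE TORUS WINDOW SEPARATES `z ≠ 0` FROM THE ORIGIN EVENTUALLY IN THE VOLUME** (once `2L^{m+K−j} > |z_i|`) — the letters' «eventually in `K`» absorbs the window's
periodicity. [cite: Balaban1987RG1, (1.21) p.264; model] -/
theorem siteOfInt_eventually_ne (j : ℕ) {z : Fin 4 → ℤ} (hz : z ≠ 0) :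
    ∀ᶠ K in atTop, siteOfInt F K j z ≠ siteOfInt F K j 0 := by
  obtain ⟨i₀, hi₀⟩ : ∃ i₀, z i₀ ≠ 0 := Function.ne_iff.1 hz
  refine eventually_atTop.2 ⟨j + (z i₀).natAbs, fun K hK h => hi₀ ?_⟩
  have hL : 1 < F.L := F.hL.2
  have h1 : ((z i₀ : ℤ) : ZMod ((F.P K).sitesPerDir j)) = 0 := by
    have := congrFun h (Fin.cast (F.P_d K).symm i₀)
    simpa [siteOfInt] using this
  rw [ZMod.intCast_zmod_eq_zero_iff_dvd] at h1
  refine Int.eq_zero_of_dvd_of_natAbs_lt_natAbs h1 ?_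
  rw [Int.natAbs_natCast]
  show (z i₀).natAbs < 2 * F.L ^ (F.m + K - j)
  calc (z i₀).natAbs < F.L ^ (z i₀).natAbs := Nat.lt_pow_self hL
    _ ≤ F.L ^ (F.m + K - j) := Nat.pow_le_pow_right (by omega) (by omega)
    _ ≤ 2 * F.L ^ (F.m + K - j) := Nat.le_mul_of_pos_left _ (by norm_num)

/-- ★ **EVENTUALLY THE WINDOWED KERNEL IS THE ON-SITE KERNEL** `fadingAmp ω k v · [μ = ν = 0] · [z = 0]`. [cite: Balaban1987RG1, (1.20)–(1.21) p.264; model] -/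
theorem polWindow_fadingTermFamily_eventually (ω : ℝ) (k : ℕ) (v : Fin (k + 1) → ℝ) (μ ν : Fin 4) (z : Fin 4 → ℤ) :
    ∀ᶠ K in atTop, polWindow F K (k + 1) (fadingTermFamily F ω k v K) (ContinuousLinearMap.id ℝ ℝ) (Module.Basis.singleton Unit ℝ) μ ν z =
      if μ = 0 ∧ ν = 0 ∧ z = 0 then fadingAmp ω k v else 0 := by
  by_cases hz : z = 0
  · subst hz
    exact Eventually.of_forall fun K => by rw [polWindow_fadingTermFamily]; simp
  · filter_upwards [siteOfInt_eventually_ne F (k + 1) hz] with K hK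
    rw [polWindow_fadingTermFamily]
    simp [hz, hK]

/-- **THE (1.21) LIMIT IN CLOSED FORM**: def-B's `polLimit` (a `limUnder` of an eventually constant sequence) of the model at history `v` is the on-site kernel
`fadingAmp ω k v · [μ = ν = 0] · [z = 0]`. [cite: Balaban1987RG1, (1.21) p.264; model] -/
theorem polLimit_fadingTermFamily (ω : ℝ) (k : ℕ) (v : Fin (k + 1) → ℝ) (μ ν : Fin 4) (z : Fin 4 → ℤ) :
    polLimit F (k + 1) (fun K => fadingTermFamily F ω k v K) (ContinuousLinearMap.id ℝ ℝ) (Module.Basis.singleton Unit ℝ) μ ν z =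
      if μ = 0 ∧ ν = 0 ∧ z = 0 then fadingAmp ω k v else 0 := by
  have h : (fun K : ℕ => polWindow F K (k + 1) (fadingTermFamily F ω k v K) (ContinuousLinearMap.id ℝ ℝ) (Module.Basis.singleton Unit ℝ) μ ν z)
      =ᶠ[atTop] fun _ => if μ = 0 ∧ ν = 0 ∧ z = 0 then fadingAmp ω k v else 0 :=
    polWindow_fadingTermFamily_eventually F ω k v μ ν z
  exact (tendsto_const_nhds.congr' h.symm).limUnder_eq

/-- W1-19's limiting kernel `kernelA` of the model at a coupling sequence `g`: the on-site kernel with amplitude `fadingAmp ω k (g_0, …, g_k)`.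
[cite: Balaban1987RG1, (1.21) p.264; model] -/
theorem kernelA_fadingTermFamily (ω : ℝ) (g : ℕ → ℝ) (k : ℕ) (μ ν : Fin 4) (z : Fin 4 → ℤ) :
    kernelA F (fadingTermFamily F ω) (ContinuousLinearMap.id ℝ ℝ) (Module.Basis.singleton Unit ℝ) g k μ ν z =
      if μ = 0 ∧ ν = 0 ∧ z = 0 then fadingAmp ω k (histPrefix g k) else 0 :=
  polLimit_fadingTermFamily F ω k (histPrefix g k) μ ν z

/-- **… BUT ITS β IS IDENTICALLY ZERO**: the (1.22) read-out `β_{k+1} = Σ_z Π_{01}(z) z_0 z_1` (def-B's `betaMerged`) vanishes at every history — the off-diagonal entry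
`Π_{01}` of a direction-`0` on-site kernel is `0`.  So kernels can READ the couplings (§4 `sensitiveOnBoxes_fading`) while β is BOXWISE CONSTANT: kernel-level sensitivity
does NOT force β non-degeneracy (the converse of dag-n18-w2's `sensitiveOnBoxes_objects_of_not_boxwiseConstant` fails). [cite: Balaban1987RG1, (1.22) p.264; model] -/
theorem betaMerged_fadingTermFamily (ω : ℝ) (k : ℕ) (v : Fin (k + 1) → ℝ) :
    Node00.betaMerged F (fadingTermFamily F ω) (ContinuousLinearMap.id ℝ ℝ) (Module.Basis.singleton Unit ℝ) k v = 0 := by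
  simp [Node00.betaMerged, B12Beta.secondMoment, polLimit_fadingTermFamily]

/-- The model's β is boxwise constant on every window radius (dag-n18-w2 g0's `BoxwiseConstant`). [folklore] -/
theorem boxwiseConstant_betaMerged_fading (ω γ : ℝ) :
    YMDAG.N18.U3Guards.BoxwiseConstant γ (Node00.betaMerged F (fadingTermFamily F ω) (ContinuousLinearMap.id ℝ ℝ) (Module.Basis.singleton Unit ℝ)) :=
  fun k v v' _ _ => by rw [betaMerged_fadingTermFamily, betaMerged_fadingTermFamily]

end Model

/-! ## §3 The finite-volume letters (and the letters they feed) at the model -/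

section Letters

variable (F : T4Family)

/-- `g ∈ Window γ` puts every history prefix in the box. [folklore] -/
theorem histPrefix_mem_box {γ : ℝ} {g : ℕ → ℝ} (hg : g ∈ Window γ) (k : ℕ) : histPrefix g k ∈ Box γ k :=
  fun i _ => ⟨(hg i).1, (hg i).2⟩

/-- **THE INCREMENTS LETTER AT THE MODEL, EVERY RATIO `r`** (the windowed kernels are eventually CONSTANT in `K`; constant `C := 0`). [cite: Balaban1987RG1, (1.21) p.264; model] -/
theorem geometricIncrements_fading (ω γ r : ℝ) :
    GeometricIncrements F (fadingTermFamily F ω) (ContinuousLinearMap.id ℝ ℝ) (Module.Basis.singleton Unit ℝ) (Window γ) r := by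
  intro g _ k μ ν z
  obtain ⟨K₀, hK₀⟩ := eventually_atTop.1 (polWindow_fadingTermFamily_eventually F ω k (histPrefix g k) μ ν z)
  refine ⟨K₀, 0, fun K hK => ?_⟩
  rw [hK₀ (K + 1) (le_trans hK (Nat.le_succ K)), hK₀ K hK, sub_self, abs_zero, zero_mul]

/-- The (1.21)-existence letter at the model (this seat's `polLimitsExist_of_geometricIncrements` at ratio `0`). [cite: Balaban1987RG1, (1.21) p.264; model] -/
theorem polLimitsExist_fading (ω γ : ℝ) :
    PolLimitsExist F (fadingTermFamily F ω) (ContinuousLinearMap.id ℝ ℝ) (Module.Basis.singleton Unit ℝ) (Window γ) :=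
  YMDAG.N18.PolLimitRate.polLimitsExist_of_geometricIncrements F _ _ _ zero_lt_one (geometricIncrements_fading F ω γ 0)

/-- **THE WINDOWED (5.10) LETTER AT THE MODEL, EVERY RATE `κ`** (constant `|γ|·ω∕(1−ω)`, uniform in the level; `0 ≤ ω < 1`). [cite: Balaban1987RG1, (5.10) p.293; model] -/
theorem windowedDecay_fading {ω : ℝ} (hω : 0 ≤ ω) (hω1 : ω < 1) (γ : ℝ) (μ ν : Fin 4) (κ : ℝ) :
    WindowedDecay F (fadingTermFamily F ω) (ContinuousLinearMap.id ℝ ℝ) (Module.Basis.singleton Unit ℝ) (Window γ) μ ν κ := by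
  intro g hg
  refine ⟨|γ| * (ω / (1 - ω)), fun k z => ?_⟩
  filter_upwards [polWindow_fadingTermFamily_eventually F ω k (histPrefix g k) μ ν z] with K hK
  rw [hK]
  have hC : 0 ≤ |γ| * (ω / (1 - ω)) := mul_nonneg (abs_nonneg γ) (div_nonneg hω (sub_nonneg.2 hω1.le))
  split_ifs with h
  · obtain ⟨-, -, rfl⟩ := h
    have h0 : l1 (0 : Fin 4 → ℤ) = 0 := by simp [l1]
    rw [h0, mul_zero, Real.exp_zero, mul_one]
    exact abs_fadingAmp_le hω hω1 (histPrefix_mem_box hg k)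
  · rw [abs_zero]
    exact mul_nonneg hC (Real.exp_nonneg _)

/-- **THE LETTER BLOCK OF THE MODEL** `⟨κ, θ₅, C₅, C₉, ω, cr, ρ⟩ := ⟨1, ω, |γ|·ω, 1, ω, 0, ω⟩`. [cite: Balaban1987RG1, (1.20)–(1.22) p.264 (hypothesis dictionary); model] -/
def fadingLetters (γ ω : ℝ) : U3Letters₁₁ := ⟨1, ω, |γ| * ω, 1, ω, 0, ω⟩

/-- The letter block passes the displayed letter signs for `0 < ω < 1`. [folklore] -/
theorem fadingLetters_signs (γ : ℝ) {ω : ℝ} (hω : 0 < ω) (hω1 : ω < 1) : (fadingLetters γ ω).Signs :=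
  ⟨zero_le_one, hω, hω1, mul_nonneg (abs_nonneg γ) hω.le, zero_le_one, hω.le, hω1, le_rfl, le_rfl, le_rfl, hω1⟩

/-- The block's history moduli are `ω^{n−i}`. [folklore] -/
theorem fadingLetters_moduli (γ ω : ℝ) (n i : ℕ) : (fadingLetters γ ω).moduli n i = ω ^ (n - i) := by simp [fadingLetters, U3Letters₁₁.moduli]

/-- **THE WINDOWED NE9 LETTER AT THE MODEL, EVERY RATE `κ`**, moduli `ω^{k+1−i}` (the model's history-Lipschitz modulus IS the fading sum; `0 ≤ ω`). [cite: Balaban1987RG1, (1.18) p.263; model] -/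
theorem windowedNE9_fading {ω : ℝ} (hω : 0 ≤ ω) (γ κ : ℝ) :
    WindowedNE9 F (fadingTermFamily F ω) (ContinuousLinearMap.id ℝ ℝ) (Module.Basis.singleton Unit ℝ) (Window γ) κ (fadingLetters γ ω).moduli := by
  intro g _ g' _ k μ ν z
  filter_upwards [polWindow_fadingTermFamily_eventually F ω k (histPrefix g k) μ ν z,
    polWindow_fadingTermFamily_eventually F ω k (histPrefix g' k) μ ν z] with K hK hK'
  rw [hK, hK']
  have hsum : 0 ≤ ∑ i ∈ Finset.range (k + 1), (fadingLetters γ ω).moduli (k + 1) i * |g i - g' i| :=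
    Finset.sum_nonneg fun i _ => mul_nonneg (by rw [fadingLetters_moduli]; exact pow_nonneg hω _) (abs_nonneg _)
  split_ifs with h
  · obtain ⟨-, -, rfl⟩ := h
    have h0 : l1 (0 : Fin 4 → ℤ) = 0 := by simp [l1]
    rw [h0, mul_zero, neg_zero, Real.exp_zero, one_mul]
    refine (abs_fadingAmp_sub_le hω k _ _).trans (le_of_eq ?_)
    simp only [Node00.U3OfKernels.histPrefix_apply]
    rw [Fin.sum_univ_eq_sum_range (fun i => ω ^ (k + 1 - i) * |g i - g' i|) (k + 1)]
    exact Finset.sum_congr rfl fun i _ => by rw [fadingLetters_moduli]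
  · rw [sub_self, abs_zero]
    exact mul_nonneg (Real.exp_nonneg _) hsum

/-- ★ **THE WINDOWED TWO-RUN STEP RATE AT THE MODEL, EVERY RUN OFFSET `s` AND RATE `κ`** (`θ₅ = ω`, constant `(|γ|ω)·ω` = the letter's `C₅·θ₅` shape): by
`fadingAmp_succ` the two-run discrepancy at the origin is the oldest coupling's weight `ω^{k+2} w_0 ≤ |γ| ω^{k+2}` (`0 ≤ ω`). [cite: Balaban1987RG1, Thm 1 p.259; model] -/
theorem windowedStepRate_fading {ω : ℝ} (hω : 0 ≤ ω) (γ : ℝ) (s : ℕ) (κ : ℝ) :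
    WindowedStepRate F (fadingTermFamily F ω) (ContinuousLinearMap.id ℝ ℝ) (Module.Basis.singleton Unit ℝ) γ s κ ω ((|γ| * ω) * ω) := by
  intro k w hw μ ν x
  obtain ⟨K₁, hK₁⟩ := eventually_atTop.1 (polWindow_fadingTermFamily_eventually F ω (k + 1) w μ ν x)
  obtain ⟨K₂, hK₂⟩ := eventually_atTop.1 (polWindow_fadingTermFamily_eventually F ω k (Fin.tail w) μ ν x)
  refine eventually_atTop.2 ⟨max K₁ K₂, fun K hK => ?_⟩
  rw [hK₁ (K + s) ((le_of_max_le_left hK).trans (Nat.le_add_right K s)), hK₂ K (le_of_max_le_right hK)]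
  have hC : 0 ≤ (|γ| * ω) * ω * ω ^ k * Real.exp (-κ * l1 x) :=
    mul_nonneg (mul_nonneg (mul_nonneg (mul_nonneg (abs_nonneg γ) hω) hω) (pow_nonneg hω k)) (Real.exp_nonneg _)
  split_ifs with h
  · obtain ⟨-, -, rfl⟩ := h
    have h0 : l1 (0 : Fin 4 → ℤ) = 0 := by simp [l1]
    have hw0 := hw 0 (Set.mem_univ _)
    rw [h0, mul_zero, Real.exp_zero, mul_one, fadingAmp_succ, add_sub_cancel_right, abs_mul, abs_of_nonneg (pow_nonneg hω _),
      abs_of_pos hw0.1]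
    calc ω ^ (k + 2) * w 0 ≤ ω ^ (k + 2) * |γ| := mul_le_mul_of_nonneg_left (hw0.2.trans (le_abs_self γ)) (pow_nonneg hω _)
      _ = (|γ| * ω) * ω * ω ^ k := by ring
  · rwa [sub_self, abs_zero]

/-- ★ **NODE N18's LETTER AT THE MODEL** `KernelStepRate … γ κ ω (|γ|ω)` (p606911 `kernelStepRate_of_geometricIncrements_of_windowed` on §3's letters; `0 ≤ ω`). [cite: Balaban1987RG1, Thm 1 p.259; model] -/
theorem kernelStepRate_fading {ω : ℝ} (hω : 0 ≤ ω) (γ κ : ℝ) :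
    KernelStepRate F (fadingTermFamily F ω) (ContinuousLinearMap.id ℝ ℝ) (Module.Basis.singleton Unit ℝ) γ κ ω (|γ| * ω) :=
  YMDAG.N18.PolLimitRate.kernelStepRate_of_geometricIncrements_of_windowed F _ _ 0 zero_lt_one (geometricIncrements_fading F ω γ 0)
    (windowedStepRate_fading F hω γ 0 κ)

/-- NE9 of the model's kernel functional (dag-n22-w3's `ne9_EA_of_windowed` on §3's letters). [cite: Balaban1987RG1, (1.18) p.263; model] -/
theorem ne9_EA_fading {ω : ℝ} (hω : 0 ≤ ω) (γ κ : ℝ) :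
    NE9 (EA F (fadingTermFamily F ω) (ContinuousLinearMap.id ℝ ℝ) (Module.Basis.singleton Unit ℝ)) (Window γ) κ (fadingLetters γ ω).moduli :=
  YMDAG.N22.AtKernels.ne9_EA_of_windowed F _ _ _ (polLimitsExist_fading F ω γ) (windowedNE9_fading F hω γ κ)

/-- The (5.10)-class binder of the limiting kernels at the model (dag-n22-w3's `kernelDecay_of_windowed` on §3's letters). [cite: Balaban1987RG1, (5.10) p.293; model] -/
theorem kernelDecay_fading {ω : ℝ} (hω : 0 ≤ ω) (hω1 : ω < 1) (γ : ℝ) (μ ν : Fin 4) (κ : ℝ) :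
    KernelDecay F (fadingTermFamily F ω) (ContinuousLinearMap.id ℝ ℝ) (Module.Basis.singleton Unit ℝ) (Window γ) μ ν κ :=
  YMDAG.N22.AtKernels.kernelDecay_of_windowed F _ _ _ (polLimitsExist_fading F ω γ) (windowedDecay_fading F hω hω1 γ μ ν κ)

end Letters

/-! ## §4 At node U3's kernel objects: N18, N22, and the coupling-sensitivity guard -/

section Nodes

variable (F : T4Family) {N : ℕ} [NeZero N]

/-- **N18 AT THE MODEL's KERNEL OBJECTS** for every Stage-13 tuple `θ` and run length (dag-n18-w1's `…_iff_kernelStepRate_letter`; `0 < ω`).  MODEL LEVEL. [cite: Balaban1987RG1, Thm 1 p.259; model] -/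
theorem n18At_fading {ω : ℝ} (hω : 0 < ω) (θ : Stage13Params F N) (k : ℕ) :
    N18At (u3OfRecord₁₃ θ (objects F (fadingTermFamily F ω) (ContinuousLinearMap.id ℝ ℝ) (Module.Basis.singleton Unit ℝ) (fadingLetters θ.γ ω)) k) :=
  (YMDAG.N18.AtRecordOfKernelLetters.n18At_u3OfRecord₁₃_objects_iff_kernelStepRate_letter F _ _ _ θ (fadingLetters θ.γ ω) k).2
    (kernelStepRate_fading F hω.le θ.γ 1)

/-- **N22 AT THE MODEL's KERNEL OBJECTS** for every Stage-13 tuple and run length (dag-n22-w3's `…_objects_of_ne9`; `0 < ω < 1`).  MODEL LEVEL. [cite: Balaban1987RG1, (1.18) p.263; model] -/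
theorem n22At_fading {ω : ℝ} (hω : 0 < ω) (hω1 : ω < 1) (θ : Stage13Params F N) (k : ℕ) :
    N22At (u3OfRecord₁₃ θ (objects F (fadingTermFamily F ω) (ContinuousLinearMap.id ℝ ℝ) (Module.Basis.singleton Unit ℝ) (fadingLetters θ.γ ω)) k) :=
  YMDAG.N22.AtKernels.n22At_u3OfRecord₁₃_objects_of_ne9 F _ _ _ θ (fadingLetters θ.γ ω) (fadingLetters_signs θ.γ hω hω1) k (ne9_EA_fading F hω.le θ.γ 1)

/-- ★ **THE MODEL's KERNELS ARE NON-ZERO AND COUPLING-SENSITIVE OVER THE BOXES** (dag-n18-w2 g0's guard, via p592505 `sensitiveOnBoxes_objects_iff_kernels`): at level `0`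
the box histories `(γ)`, `(γ∕2)` give on-site limiting kernels `ωγ ≠ ωγ∕2` (`ω, γ > 0`). [folklore] -/
theorem sensitiveOnBoxes_fading {ω γ : ℝ} (hω : 0 < ω) (hγ : 0 < γ) (ℓ : U3Letters₁₁) (k : ℕ) :
    SensitiveOnBoxes ((objects F (fadingTermFamily F ω) (ContinuousLinearMap.id ℝ ℝ) (Module.Basis.singleton Unit ℝ) ℓ).EA k) γ := by
  rw [YMDAG.N18.U3GuardsAtKernels.sensitiveOnBoxes_objects_iff_kernels]
  refine ⟨0, fun _ => γ, fun _ => γ / 2, fun i _ => ⟨hγ, le_rfl⟩, fun i _ => ⟨half_pos hγ, half_le_self hγ.le⟩, 0, 0, 0, 0, ?_⟩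
  rw [kernelA_fadingTermFamily, kernelA_fadingTermFamily]
  simp only [and_self, if_true, Node00.U3OfKernels.histPrefix_extd, fadingAmp_zero]
  intro h
  have : ω * γ = ω * (γ / 2) := h
  nlinarith [mul_pos hω hγ]

end Nodes

end YMDAG.N18.FiniteVolumeLettersModel

end
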